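import Summits.SmoothPoincare4.SmoothPoincare4.Theorems.InformationMetricHadamardConvexEndRecognitionRays
import Literature.Topology.FourManifolds.WhitneyModelSheets
import Mathlib.Geometry.Manifold.Instances.Sphere

/-!
# The smooth frontier of a compact convex body in a Cartan–Hadamard manifold is a standard sphere

Helper file for route InformationMetricHadamard: the recognition engine behind the items
`HadamardConvexBoundarySphere` (stmt-SmoothPoincare4-6016, whose statement is the case `n = 4` of
`nonempty_diffeomorph_sphere_of_convex` up to the packaging of completeness and curvature) and
`ConvexEndRecognition` (stmt-SmoothPoincare4-6017).

`nonempty_diffeomorph_sphere_of_convex`: let `M` be a simply connected, geodesically complete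
Riemannian `(n+1)`-manifold with `Rm(X,Y,Y,X) ≤ 0`, `K ⊆ M` compact with nonempty interior and
convex in the betweenness sense, and `j : N → M` an injective immersion of an `n`-manifold with
`range j = frontier K`. Then `N ≅ Sⁿ`: the radial projection from an interior point `o`,
`x ↦ exp_o⁻¹(j x)/‖exp_o⁻¹(j x)‖`, is smooth, bijective (each ray from `o` leaves `K` exactly once,
`exists_pos_expMap_smul_mem_frontier`, `eq_of_expMap_smul_mem_frontier`) and has injective
differential (the frontier is transverse to the rays, `not_mem_range_mfderiv_of_expMap_mem_interior`),
hence is a diffeomorphism (inverse function theorem + Mathlib's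
`IsLocalDiffeomorph.diffeomorphOfBijective`).

Everything is proved; no definitions, no named facts.

References: J. M. Lee, *Introduction to Riemannian Manifolds* (2018), Thm. 12.8, Prop. 12.9;
P. Eberlein, B. O'Neill, *Visibility manifolds*, Pacific J. Math. 46 (1973).
-/

noncomputable section

-- the registered namespace `Summit.SmoothPoincare4.SmoothPoincare4.Theorems` repeats a component
set_option linter.dupNamespace false

open Bundle Set Filter Function TopologicalSpace Bornology Metric Module
open scoped Manifold ContDiff Topology ENNReal Pointwise

namespace Summit.SmoothPoincare4.SmoothPoincare4.Theorems.HadamardConvex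

open Literature.Geometry.Lorentzian Literature.Geometry.Lorentzian.PseudoRiemannianMetric
  Literature.Geometry.Riemannian Literature.Geometry.Riemannian.SimpleAH
  Literature.Topology.FourManifolds

set_option maxSynthPendingDepth 3

section General

variable {E : Type*} [NormedAddCommGroup E] [NormedSpace ℝ E] {H : Type*} [TopologicalSpace H]
  {I : ModelWithCorners ℝ E H} {M : Type*} [TopologicalSpace M] [ChartedSpace H M]

/-- Transport of `exp_q v = exp_{q'} v` along an equality of base points `q = q'` (the tangent
spaces are all the model space `E`). [folklore] -/
theorem expMap_congr_point [IsManifold I ∞ M] [FiniteDimensional ℝ E]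
    (cov : CovariantDerivative I E (TangentSpace I : M → Type _)) {q q' : M} (h : q = q') (v : E) :
    expMap cov q (show TangentSpace I q from v) = expMap cov q' (show TangentSpace I q' from v) := by
  subst h; rfl

/-- **Radial vectors span the kernel of the differential of the Euclidean normalization**: if
`w ≠ 0` and `D(w ↦ w/‖w‖)_w (η) = 0` then `η` is a multiple of `w` (differentiate the identity
`‖w'‖ • (w'/‖w'‖) = w'` at `w`). [folklore] -/
theorem exists_smul_of_fderiv_normalize_eq_zero {V : Type*} [NormedAddCommGroup V]
    [InnerProductSpace ℝ V] {w η : V} (hw : w ≠ 0)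
    (h : fderiv ℝ (fun w' : V ↦ ‖w'‖⁻¹ • w') w η = 0) : ∃ c : ℝ, η = c • w := by
  have hne : IsOpen {w' : V | w' ≠ 0} := isOpen_ne
  have hnr_d : HasFDerivAt (fun w' : V ↦ ‖w'‖⁻¹ • w')
      (fderiv ℝ (fun w' : V ↦ ‖w'‖⁻¹ • w') w) w :=
    ((contDiffOn_normalize.contDiffAt (hne.mem_nhds hw)).differentiableAt (by simp)).hasFDerivAt
  have hnorm_d : HasFDerivAt (fun w' : V ↦ ‖w'‖) (fderiv ℝ (fun w' : V ↦ ‖w'‖) w) w :=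
    ((contDiffAt_norm ℝ hw : ContDiffAt ℝ 1 _ w).differentiableAt one_ne_zero).hasFDerivAt
  have hprod := hnorm_d.smul hnr_d
  have hid : HasFDerivAt (fun w' : V ↦ ‖w'‖ • ‖w'‖⁻¹ • w') (ContinuousLinearMap.id ℝ V) w := by
    refine (hasFDerivAt_id w).congr_of_eventuallyEq ?_
    filter_upwards [hne.mem_nhds hw] with w' hw'
    simp only [id_eq]
    rw [smul_smul, mul_inv_cancel₀ (norm_ne_zero_iff.2 hw'), one_smul]
  have huniq := hprod.unique hid
  have happ := congrArg (fun f : V →L[ℝ] V ↦ f η) huniq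
  have happ' : ‖w‖ • fderiv ℝ (fun w' : V ↦ ‖w'‖⁻¹ • w') w η +
      fderiv ℝ (fun w' : V ↦ ‖w'‖) w η • (‖w‖⁻¹ • w) = η := happ
  rw [h, smul_zero, zero_add] at happ'
  refine ⟨fderiv ℝ (fun w' : V ↦ ‖w'‖) w η * ‖w‖⁻¹, ?_⟩
  rw [mul_smul]
  exact happ'.symm

end General

variable {n : ℕ} {M : Type*} [TopologicalSpace M] [T2Space M]
  [ChartedSpace (EuclideanSpace ℝ (Fin (n + 1))) M] [IsManifold (𝓡 (n + 1)) ∞ M]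
  [SimplyConnectedSpace M]
  {g : PseudoRiemannianMetric (𝓡 (n + 1)) ∞ (EuclideanSpace ℝ (Fin (n + 1)))
    (TangentSpace (𝓡 (n + 1)) : M → Type _)} [g.HasLeviCivita]
  [CovariantDerivative.ContMDiffCovariantDerivative g.leviCivita 1]
  [CovariantDerivative.ContMDiffCovariantDerivative g.leviCivita ∞]

set_option maxHeartbeats 800000 in
/-- **The smooth frontier of a compact convex body in a Cartan–Hadamard manifold is a sphere**
(Lee 2018, Thm. 12.8 with Prop. 12.9; Eberlein–O'Neill 1973, §1): for `M` simply connected,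
geodesically complete with `Rm(X,Y,Y,X) ≤ 0`, `K ⊆ M` compact, convex (betweenness form) with an
interior point, and `j : N → M` an injective immersion of an `n`-manifold onto `frontier K`, the
radial projection from an interior point is a diffeomorphism `N ≅ Sⁿ`. [cite: Lee2018, Thm. 12.8] -/
theorem nonempty_diffeomorph_sphere_of_convex (hg : g.IsRiemannian)
    (hc : IsGeodesicallyComplete g.leviCivita)
    (hsec : ∀ (x : M) (X Y : TangentSpace (𝓡 (n + 1)) x),
      g.curvatureForm g.leviCivita x X Y Y X ≤ 0)
    {K : Set M} (hKc : IsCompact K) (hKi : (interior K).Nonempty)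
    (hK : ∀ a ∈ K, ∀ b ∈ K, ∀ m : M, g.edist hg a m + g.edist hg m b = g.edist hg a b → m ∈ K)
    {N : Type*} [TopologicalSpace N] [ChartedSpace (EuclideanSpace ℝ (Fin n)) N]
    [IsManifold (𝓡 n) ∞ N] {j : N → M} (hj : ContMDiff (𝓡 n) (𝓡 (n + 1)) ∞ j)
    (hjinj : Injective j) (hjimm : ∀ x : N, Injective (mfderiv (𝓡 n) (𝓡 (n + 1)) j x))
    (hjr : range j = frontier K) :
    Nonempty (N ≃ₘ⟮𝓡 n, 𝓡 n⟯ Metric.sphere (0 : EuclideanSpace ℝ (Fin (n + 1))) 1) := by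
  haveI : LocallyPathConnectedSpace M :=
    ChartedSpace.locallyPathConnectedSpace (EuclideanSpace ℝ (Fin (n + 1))) M
  haveI hfact : Fact (finrank ℝ (EuclideanSpace ℝ (Fin (n + 1))) = n + 1) :=
    ⟨finrank_euclideanSpace_fin⟩
  obtain ⟨o, ho⟩ := hKi
  -- `exp_o` as a diffeomorphism `Φ`, written `F` as a function
  obtain ⟨Φ, hΦ⟩ := exists_expDiffeomorph hg hc hsec o
  set F : EuclideanSpace ℝ (Fin (n + 1)) → M :=
    fun u ↦ expMap g.leviCivita o (show TangentSpace (𝓡 (n + 1)) o from u) with hFdef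
  have hΦF : ∀ u, Φ u = F u := fun u ↦ congr_fun hΦ u
  have hF0 : F 0 = o := expMap_zero (cov := g.leviCivita) o
  have hKcl : IsClosed K := hKc.isClosed
  have hjfr : ∀ x, j x ∈ frontier K := fun x ↦ hjr ▸ mem_range_self x
  have hjK : ∀ x, j x ∈ K := fun x ↦ hKcl.frontier_subset (hjfr x)
  have hjni : ∀ x, j x ∉ interior K := fun x h ↦ (hjfr x).2 h
  have hw_ne : ∀ x, Φ.symm (j x) ≠ 0 := by
    intro x h0
    have h1 : j x = o := by rw [← Φ.apply_symm_apply (j x), h0, hΦF, hF0]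
    exact hjni x (h1 ▸ ho)
  -- Euclidean normalization and the radial projection
  set enrm : EuclideanSpace ℝ (Fin (n + 1)) → EuclideanSpace ℝ (Fin (n + 1)) :=
    fun w ↦ ‖w‖⁻¹ • w with henrm
  have henrm_norm : ∀ w, w ≠ 0 → ‖enrm w‖ = 1 := by
    intro w hw
    simp only [henrm]
    rw [norm_smul, norm_inv, norm_norm, inv_mul_cancel₀ (norm_ne_zero_iff.2 hw)]
  have henrm_smul : ∀ (r : ℝ) (w : EuclideanSpace ℝ (Fin (n + 1))), 0 < r → w ≠ 0 →
      enrm (r • w) = enrm w := by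
    intro r w hr hw
    simp only [henrm]
    rw [norm_smul, Real.norm_eq_abs, abs_of_pos hr, mul_inv, smul_smul, mul_comm (r⁻¹), mul_assoc,
      inv_mul_cancel₀ hr.ne', mul_one]
  set lam : N → EuclideanSpace ℝ (Fin (n + 1)) := fun x ↦ enrm (Φ.symm (j x)) with hlam
  have hlam_mem : ∀ x, lam x ∈ Metric.sphere (0 : EuclideanSpace ℝ (Fin (n + 1))) 1 := fun x ↦ by
    rw [mem_sphere_zero_iff_norm]
    exact henrm_norm _ (hw_ne x)
  set La : N → Metric.sphere (0 : EuclideanSpace ℝ (Fin (n + 1))) 1 :=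
    Set.codRestrict lam _ hlam_mem with hLa
  -- smoothness
  have hG_s : ContMDiff (𝓡 n) 𝓘(ℝ, EuclideanSpace ℝ (Fin (n + 1))) ∞ fun x ↦ Φ.symm (j x) :=
    Φ.symm.contMDiff.comp hj
  have henrm_d : ContMDiffOn 𝓘(ℝ, EuclideanSpace ℝ (Fin (n + 1))) 𝓘(ℝ, EuclideanSpace ℝ (Fin (n + 1)))
      ∞ enrm {w | w ≠ 0} := contDiffOn_normalize.contMDiffOn
  have hlam_s : ContMDiff (𝓡 n) 𝓘(ℝ, EuclideanSpace ℝ (Fin (n + 1))) ∞ lam :=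
    henrm_d.comp_contMDiff hG_s fun x ↦ hw_ne x
  have hLa_s : ContMDiff (𝓡 n) (𝓡 n) ∞ La := hlam_s.codRestrict_sphere hlam_mem
  -- injectivity: a ray meets the frontier once
  have hLa_inj : Injective La := by
    intro x₁ x₂ h
    have h' : lam x₁ = lam x₂ := congrArg Subtype.val h
    set w₁ := Φ.symm (j x₁) with hw₁
    set w₂ := Φ.symm (j x₂) with hw₂
    set c : ℝ := ‖w₂‖ * ‖w₁‖⁻¹ with hcdef
    have hc0 : 0 < c :=
      mul_pos (norm_pos_iff.2 (hw_ne x₂)) (inv_pos.2 (norm_pos_iff.2 (hw_ne x₁)))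
    have hθ : w₂ = c • w₁ := by
      have h2 : ‖w₂‖⁻¹ • w₂ = ‖w₁‖⁻¹ • w₁ := h'.symm
      calc w₂ = ‖w₂‖ • (‖w₂‖⁻¹ • w₂) := by
            rw [smul_smul, mul_inv_cancel₀ (norm_ne_zero_iff.2 (hw_ne x₂)), one_smul]
        _ = ‖w₂‖ • (‖w₁‖⁻¹ • w₁) := by rw [h2]
        _ = c • w₁ := by rw [smul_smul]
    have hF1 : F ((1 : ℝ) • w₁) = j x₁ := by rw [one_smul, ← hΦF]; exact Φ.apply_symm_apply _
    have hF2 : F (c • w₁) = j x₂ := by rw [← hθ, ← hΦF]; exact Φ.apply_symm_apply _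
    have hfr1 : F ((1 : ℝ) • w₁) ∈ frontier K := by rw [hF1]; exact hjfr x₁
    have hfr2 : F (c • w₁) ∈ frontier K := by rw [hF2]; exact hjfr x₂
    have hc1 : c = 1 := by
      rcases le_total 1 c with h1c | hc1
      · exact (eq_of_expMap_smul_mem_frontier hg hc hsec hKcl hK ho one_pos h1c hfr1 hfr2).symm
      · exact eq_of_expMap_smul_mem_frontier hg hc hsec hKcl hK ho hc0 hc1 hfr2 hfr1
    have h3 : w₂ = w₁ := by rw [hθ, hc1, one_smul]
    exact hjinj (Φ.symm.injective h3) |>.symm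
  -- surjectivity: every ray meets the frontier
  have hLa_surj : Surjective La := by
    intro θ
    have hθ0 : (θ : EuclideanSpace ℝ (Fin (n + 1))) ≠ 0 := ne_zero_of_mem_unit_sphere θ
    obtain ⟨s, hs, hfr⟩ := exists_pos_expMap_smul_mem_frontier hg hc hsec hKc ho hθ0
    rw [← hjr] at hfr
    obtain ⟨x, hx⟩ := hfr
    refine ⟨x, Subtype.ext ?_⟩
    have h1 : Φ.symm (j x) = s • (θ : EuclideanSpace ℝ (Fin (n + 1))) := by
      rw [hx]
      exact ((congrArg Φ.symm (hΦF (s • (θ : EuclideanSpace ℝ (Fin (n + 1)))))).symm.trans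
        (Φ.symm_apply_apply _))
    show enrm (Φ.symm (j x)) = θ
    rw [h1, henrm_smul s _ hs hθ0]
    simp only [henrm]
    rw [show ‖(θ : EuclideanSpace ℝ (Fin (n + 1)))‖ = 1 from by
      simpa only [mem_sphere_zero_iff_norm] using θ.2, inv_one, one_smul]
  -- the differential is injective: the frontier is transverse to the rays
  have hLa_loc : IsLocalDiffeomorph (𝓡 n) (𝓡 n) ∞ La := by
    intro x
    refine isLocalDiffeomorphAt_of_mfderiv_injective isOpen_univ (mem_univ x) hLa_s.contMDiffOn
      (by exact_mod_cast le_top) rfl ?_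
    -- reduce to the `E`-valued map `lam = (↑) ∘ La`
    have hval : ContMDiff (𝓡 n) 𝓘(ℝ, EuclideanSpace ℝ (Fin (n + 1))) ∞
        ((↑) : Metric.sphere (0 : EuclideanSpace ℝ (Fin (n + 1))) 1 → EuclideanSpace ℝ (Fin (n + 1))) :=
      contMDiff_coe_sphere
    have hcomp : mfderiv (𝓡 n) 𝓘(ℝ, EuclideanSpace ℝ (Fin (n + 1))) lam x =
        (mfderiv (𝓡 n) 𝓘(ℝ, EuclideanSpace ℝ (Fin (n + 1))) Subtype.val (La x)).comp
          (mfderiv (𝓡 n) (𝓡 n) La x) := by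
      have h := mfderiv_comp x (hval.mdifferentiableAt (by simp)) (hLa_s.mdifferentiableAt (by simp))
      exact h
    suffices hlam_inj : Injective (mfderiv (𝓡 n) 𝓘(ℝ, EuclideanSpace ℝ (Fin (n + 1))) lam x) by
      rw [hcomp] at hlam_inj
      have h2 : Injective ((mfderiv (𝓡 n) 𝓘(ℝ, EuclideanSpace ℝ (Fin (n + 1))) Subtype.val (La x) :
          _ → EuclideanSpace ℝ (Fin (n + 1))) ∘ (mfderiv (𝓡 n) (𝓡 n) La x)) := hlam_inj
      exact h2.of_comp
    -- the normal data at `p = j x`: `w = exp_o⁻¹ p`, radial velocity `r = d(exp_o)_w w`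
    set p := j x with hp
    set w : EuclideanSpace ℝ (Fin (n + 1)) := Φ.symm (j x) with hw
    have hw0 : w ≠ 0 := hw_ne x
    have hΦw : Φ w = p := Φ.apply_symm_apply _
    have hFw : F w = p := (hΦF w).symm.trans hΦw
    have hγ1 : maximalGeodesic g.leviCivita o w 1 = p := by
      rw [← expMap_eq_maximalGeodesic hc o]; exact hFw
    obtain ⟨r, hr⟩ : ∃ r : EuclideanSpace ℝ (Fin (n + 1)),
        r = mfderiv 𝓘(ℝ, EuclideanSpace ℝ (Fin (n + 1))) (𝓡 (n + 1)) F w w := ⟨_, rfl⟩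
    have hvel : velocity (𝓡 (n + 1)) (maximalGeodesic g.leviCivita o w) 1 = r := by
      have h := velocity_maximalGeodesic_eq_mfderiv_expMap (I := 𝓡 (n + 1)) hc o w 1
      rw [one_smul] at h
      rw [hr]; exact h
    -- the chord from `p` back to `o` is `-r`, and it ends in the interior
    have hvo : expMap g.leviCivita p (show TangentSpace (𝓡 (n + 1)) p from -r) ∈ interior K := by
      have h := expMap_neg_velocity hc o w 1
      rw [one_smul, hvel] at h
      have h' : expMap g.leviCivita (maximalGeodesic g.leviCivita o w 1)
          (show TangentSpace (𝓡 (n + 1)) (maximalGeodesic g.leviCivita o w 1) from -r) = o := h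
      rw [expMap_congr_point g.leviCivita hγ1] at h'
      rw [h']; exact ho
    have htrans := not_mem_range_mfderiv_of_expMap_mem_interior hg hc hsec hK
      (hj.mdifferentiableAt (by simp)) hjni (hjK x) hvo
    -- differentials of `Φ` and `Φ⁻¹`
    have hΨd : MDifferentiableAt (𝓡 (n + 1)) 𝓘(ℝ, EuclideanSpace ℝ (Fin (n + 1))) Φ.symm p :=
      Φ.symm.contMDiff.mdifferentiableAt (by simp)
    have hΦd : MDifferentiableAt 𝓘(ℝ, EuclideanSpace ℝ (Fin (n + 1))) (𝓡 (n + 1)) Φ w :=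
      Φ.contMDiff.mdifferentiableAt (by simp)
    have hjd : MDifferentiableAt (𝓡 n) (𝓡 (n + 1)) j x := hj.mdifferentiableAt (by simp)
    have hΦΨ : ∀ v, mfderiv 𝓘(ℝ, EuclideanSpace ℝ (Fin (n + 1))) (𝓡 (n + 1)) Φ w
        (mfderiv (𝓡 (n + 1)) 𝓘(ℝ, EuclideanSpace ℝ (Fin (n + 1))) Φ.symm p v) = v := by
      intro v
      have hΦd' : MDifferentiableAt 𝓘(ℝ, EuclideanSpace ℝ (Fin (n + 1))) (𝓡 (n + 1)) Φ
          (Φ.symm p) := by rw [← hw]; exact hΦd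
      have h := mfderiv_comp p hΦd' hΨd
      have hid : (Φ : EuclideanSpace ℝ (Fin (n + 1)) → M) ∘ Φ.symm = id :=
        funext fun q ↦ Φ.apply_symm_apply q
      rw [hid, mfderiv_id] at h
      have h1 := congrArg (fun f ↦ f v) h
      exact h1.symm
    have hmfΦ : mfderiv 𝓘(ℝ, EuclideanSpace ℝ (Fin (n + 1))) (𝓡 (n + 1)) Φ w =
        mfderiv 𝓘(ℝ, EuclideanSpace ℝ (Fin (n + 1))) (𝓡 (n + 1)) F w := by rw [hΦ]
    -- kernel computation
    refine (injective_iff_map_eq_zero _).2 fun ξ hξ ↦ ?_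
    have hlam_eq : lam = enrm ∘ (fun y ↦ Φ.symm (j y)) := rfl
    have henrm_md : MDifferentiableAt 𝓘(ℝ, EuclideanSpace ℝ (Fin (n + 1)))
        𝓘(ℝ, EuclideanSpace ℝ (Fin (n + 1))) enrm w :=
      (henrm_d.contMDiffAt (isOpen_ne.mem_nhds hw0)).mdifferentiableAt (by simp)
    have hGd : MDifferentiableAt (𝓡 n) 𝓘(ℝ, EuclideanSpace ℝ (Fin (n + 1))) (fun y ↦ Φ.symm (j y)) x :=
      hG_s.mdifferentiableAt (by simp)
    have hchain := mfderiv_comp x henrm_md hGd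
    rw [← hlam_eq] at hchain
    set η : EuclideanSpace ℝ (Fin (n + 1)) :=
      mfderiv (𝓡 n) 𝓘(ℝ, EuclideanSpace ℝ (Fin (n + 1))) (fun y ↦ Φ.symm (j y)) x ξ with hη
    have hξ' : fderiv ℝ enrm w η = 0 := by
      have h1 := congrArg (fun f ↦ f ξ) hchain
      rw [hξ] at h1
      rw [← mfderiv_eq_fderiv]
      exact h1.symm
    obtain ⟨c, hc'⟩ := exists_smul_of_fderiv_normalize_eq_zero hw0 hξ'
    -- `η = dΨ (dj ξ)`, hence `dj ξ = dΦ_w η = c • r`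
    have hηeq : η = mfderiv (𝓡 (n + 1)) 𝓘(ℝ, EuclideanSpace ℝ (Fin (n + 1))) Φ.symm p
        (mfderiv (𝓡 n) (𝓡 (n + 1)) j x ξ) := by
      have h := mfderiv_comp x hΨd hjd
      exact congrArg (fun f ↦ f ξ) h
    have h1 : mfderiv 𝓘(ℝ, EuclideanSpace ℝ (Fin (n + 1))) (𝓡 (n + 1)) Φ w η =
        mfderiv (𝓡 n) (𝓡 (n + 1)) j x ξ := by rw [hηeq]; exact hΦΨ _
    have h2 : mfderiv 𝓘(ℝ, EuclideanSpace ℝ (Fin (n + 1))) (𝓡 (n + 1)) Φ w η =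
        c • mfderiv 𝓘(ℝ, EuclideanSpace ℝ (Fin (n + 1))) (𝓡 (n + 1)) Φ w w := by
      rw [hc']
      exact (mfderiv 𝓘(ℝ, EuclideanSpace ℝ (Fin (n + 1))) (𝓡 (n + 1)) Φ w).map_smul c w
    have h3 : mfderiv 𝓘(ℝ, EuclideanSpace ℝ (Fin (n + 1))) (𝓡 (n + 1)) Φ w w = r := by
      rw [hmfΦ]; exact hr.symm
    have hdj : mfderiv (𝓡 n) (𝓡 (n + 1)) j x ξ = c • r := by rw [← h1, h2, h3]; rfl
    -- if `c ≠ 0` the chord `-r` would be tangent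
    by_cases hc0 : c = 0
    · rw [hc0, zero_smul] at hdj
      exact hjimm x (hdj.trans (map_zero _).symm)
    · exfalso
      refine htrans ⟨(-c⁻¹) • ξ, ?_⟩
      rw [map_smul, hdj]
      change (-c⁻¹ : ℝ) • ((c : ℝ) • r) = -r
      rw [smul_smul, neg_mul, inv_mul_cancel₀ hc0, neg_smul, one_smul]
  exact ⟨hLa_loc.diffeomorphOfBijective ⟨hLa_inj, hLa_surj⟩⟩

end Summit.SmoothPoincare4.SmoothPoincare4.Theorems.HadamardConvex

end
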